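import Literature.NumberTheory.LFunctions.Zhang2022.DetectorEntangledBulkFreeEnd

/-!
# Zhang (2022), programme F-S3 (cell landau-siegel §E, E-102 HEAD 1, SOS plan Part A): the `u`-variables
# `D_xG = G′ + iπx·G` and the FACTORISATION of the polar bulk form
# `T_{(a,x,y)}^{[0,1]}(G,H) = 𝔥_a(D_xG, D_yH) + [β_{a,x,y}(G,H)]₀¹`

Y. Zhang, *Discrete mean estimates and the Landau–Siegel zero*, arXiv:2211.02515v1 [Zhang2022LandauSiegel] —
an unrefereed manuscript under adjudication. **WHAT THIS IS NOT: not a claim about Theorems 1–2 of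
arXiv:2211.02515, about Landau–Siegel zeros, or about Parity; nothing here asserts any claim of the manuscript.
The programme SEARCHES and TYPES; no claim about Landau–Siegel zeros, Theorems 1–2 of arXiv:2211.02515 or a
repaired Margin232 until a kernel theorem says so.** Seat ls-Bdet-typer-1 g4 (OFFER 2026-08-27T03:40:08Z, Part A of
the head-1 SOS kernel plan of ls-barrier-p2 g4, `R3a-ENTDBL-p2.md` v2 d8f7c72260a074cf §1 step (2) / §3).

## What is here (0 named facts, 0 sorries; pure integration by parts)

The desk SOS identity for E-102 head 1 (R3a v2 (I)–(III); theory g2 referee PASS 03:39:20Z; ball twins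
kit j267202 / j267232 / j267304) factors the frequency symbol of the shift-triple bulk form,
`ξ(ξ+a)(ξ+x)(ξ+y) = [ξ(ξ+a)]·(ξ+x)·(ξ+y)`, as a DIFFERENTIAL identity: with the channel operator
`D_x G := G′ + iπx·G` (so that R3a's `u = D_xG/(iπ)`) the polar bulk form `Det.bulkPolarOn ![a,x,y] 0 1`
(`DetectorEntangledBulkFreeEnd`, Part 1) equals a SECOND-order Hermitian form in `(D_xG, D_yH)` plus a boundary
bracket:

* `Det.dOp x G G′ := fun t => G′ t + iπx·G t` (derivative data supplied: `(D_xG)′ = D_x(G′) = dOp x G′ G″`;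
  `kinkedProfile_dOp`);
* `Det.uForm a U U′ V V′ := ⟨U′,V′⟩ − (iaπ/2)(⟨U′,V⟩ − ⟨U,V′⟩)` (`⟨u,v⟩ = ∫₀¹ u·conj v`; symbol `π²ξ(ξ+a)`;
  Hermitian `conj_uForm`; diagonal `Re⟨U′,U′⟩ + aπ·Im⟨U′,U⟩`, `uForm_self_re/_im`). NORMALISATION: R3a's
  `𝔥_a(u,v) = 2π²⟨u′,v′⟩ − iaπ³(⟨u′,v⟩ − ⟨u,v′⟩)` with `u = D_xG/(iπ)` is `2·uForm a (D_xG) (D_xG′) (D_yH) (D_yH′)`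
  (division-free spelling);
* `Det.uBoundary a x y G G′ H H′ t := (iπ(y−x)/2)·G′(t)·conj H′(t) + (aπ²/2)(y·G′(t)·conj H(t) + x·G(t)·conj H′(t))`;
* **`Det.bulkPolarOn_eq_uForm`**: for `G, H` with kinked data up to second order (`KinkedProfile G G′`,
  `KinkedProfile G′ G″`, same for `H`) and EVERY real `a, x, y`,
  `bulkPolarOn ![a,x,y] 0 1 G G′ G″ H H′ H″ = uForm a (D_xG) (D_xG′) (D_yH) (D_yH′) + (uBoundary … 1 − uBoundary … 0)`
  (three applications of `Det.integral_deriv_mul_conj_add`; the `e₃`-terms and the `(x+y)`-weighted first-order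
  terms cancel identically, only the `(y−x)` commutator and the `a`-weighted terms leave boundary);
  `bulkPolarOn_eq_uForm_of_oneSided` (clamped right, `G(1) = G′(1) = 0`: `… − uBoundary … 0`);
  `kinkedProfile_tailPrim`, `entangledBulk_eq_uForm`, `entangledMain_eq_uForm` (the summed form at profile level:
  `(π/2)·m(a;b;h) = Σ Re m₀^{jl}·𝔥_a(ũ_j,ũ_l) + [entangledFreeEnd − Σ Re m₀^{jl}·β⁰]`, `ũ_j = D_{b_j}S_j`, `β⁰ = Det.uBoundaryJet`).
* **v2 (Part D of the SOS plan, ls-barrier-p2 g4 03:52:38Z «D → typer-1», statement shape as asked) — PICONE on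
  `uForm`:** `Det.uForm_eq_integral_picone` — for kinked `U, V` with `U(1) = V(1) = 0` and `θ ∈ (0, π/2)`,
  `uForm (2θ/π) U U′ V V′ = ∫₀¹ (U′ + θ(i + tan θy)·U)·conj(V′ + θ(i + tan θy)·V) dy` (pointwise the integrands
  differ by `(θ·tan(θy)·U·V̄)′`, `tan′ = 1 + tan²`, boundary `θ·tanθ·U(1)V̄(1) − 0 = 0`; ground state
  `cos θy > 0` on `[0,1]` iff `θ < π/2`), and the anchor spelling `uForm_eq_integral_picone_anchor` (`a ∈ (0,1)`,
  `θ = πa/2`).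
* **v3 (bulk Gram step of the SOS assembly):** `Det.sum_mul_uForm_eq_integral` — for `a ∈ (0,1)`, weights `R_{jl}`
  and kinked `U_j` clamped at `1`, `Σ_{j,l} R_{jl}·uForm a U_j U_l = ∫₀¹ Σ_{j,l} R_{jl}·φ_j·conj φ_l`
  (`φ_j = U_j′ + θ(i + tan θy)U_j`; the Picone fields are `L²`, so the finite sum passes under the integral), and
  **`Det.re_sum_uForm_nonneg`**: with the anchor kernel `R_{jl} = Re m₀(a,x_j,x_l)` (L-B′1 = `Det.re_ddM0_quadForm_nonneg`,
  `DetectorAnchorKernel`) the real part of that sum is `≥ 0`.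
* **v4 (head 1 reduced to the boundary bracket):** `Det.boundaryBracket a b x₁ x₂ y₁ y₂ := Σ_{jl}[freeEndPolarDD − R·uBoundaryJet]`
  (the `2K × 2K` jet form left over), `entangledMain_eq_uForm_add_boundaryBracket`,
  **`re_boundaryBracket_le_re_entangledMain`** (`Re 𝔅′(x_h,x_h) ≤ (π/2)·Re m(a;b;h)`, `a ∈ (0,1)`, every real palette) and
  the SOS interface **`conePSD_of_re_boundaryBracket_nonneg(_jets)`**: `Re 𝔅′ ≥ 0` on jets ⇒ `ConePSD a b`.
* **v5 (named glue, ls-barrier-p2 g4 04:11:14Z ASK, statement shape as asked):** `Det.re_sum_uForm_dOp_nonneg` — the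
  first summand of `entangledMain_eq_uForm`, `Σ_{jl} Re m₀(a,b_j,b_l)·uForm a ũ_j ũ_l` with `ũ_j = D_{b_j}S_j`, has
  non-negative real part for `a ∈ (0,1)` (`re_sum_uForm_nonneg` ∘ `kinkedProfile_dOp_tailPrim`).

What is NOT here: the moment identities (Part B, `DetectorEntangledMomentSOS`), the assembly of the boundary square
(Part C) and the sign statement for `Det.ConePSD` (Part E). Nothing here asserts E-102.

References: Y. Zhang, arXiv:2211.02515v1 (2022), Prop 7.1 p.44 with (7.2), (7.19)–(7.21); §8 (8.11)–(8.23).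
[cite: Zhang2022LandauSiegel, Prop 7.1 p.44; §8 (8.11)–(8.23)]
-/

noncomputable section

open Complex Real Set intervalIntegral
open _root_.MeasureTheory
open scoped ComplexConjugate

namespace Literature.NumberTheory.LFunctions.Zhang2022

open Repair

namespace Det

/-- `conj ⟨v,u⟩ = ⟨u,v⟩` (`⟨u,v⟩ = ∫₀¹ u·conj v`). [folklore] -/
private theorem conj_integral_mul_conj' (u v : ℝ → ℂ) :
    conj (∫ x in (0:ℝ)..1, v x * conj (u x)) = ∫ x in (0:ℝ)..1, u x * conj (v x) := by
  have h : conj (∫ x in (0:ℝ)..1, v x * conj (u x)) = ∫ x in (0:ℝ)..1, conj (v x * conj (u x)) := by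
    simp only [intervalIntegral, map_sub, integral_conj]
  rw [h]
  refine intervalIntegral.integral_congr fun x _ => ?_
  simp [mul_comm]

/-- Linearity of `∫₀¹` over four weighted integrable terms. [folklore] -/
private theorem integral_lin4' {f1 f2 f3 f4 : ℝ → ℂ} (c1 c2 c3 c4 : ℂ)
    (h1 : IntervalIntegrable f1 volume 0 1) (h2 : IntervalIntegrable f2 volume 0 1)
    (h3 : IntervalIntegrable f3 volume 0 1) (h4 : IntervalIntegrable f4 volume 0 1) :
    ∫ x in (0:ℝ)..1, (c1 * f1 x + c2 * f2 x + c3 * f3 x + c4 * f4 x)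
      = c1 * (∫ x in (0:ℝ)..1, f1 x) + c2 * (∫ x in (0:ℝ)..1, f2 x)
        + c3 * (∫ x in (0:ℝ)..1, f3 x) + c4 * (∫ x in (0:ℝ)..1, f4 x) := by
  rw [intervalIntegral.integral_add (((h1.const_mul c1).add (h2.const_mul c2)).add (h3.const_mul c3))
      (h4.const_mul c4),
    intervalIntegral.integral_add ((h1.const_mul c1).add (h2.const_mul c2)) (h3.const_mul c3),
    intervalIntegral.integral_add (h1.const_mul c1) (h2.const_mul c2),
    intervalIntegral.integral_const_mul, intervalIntegral.integral_const_mul,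
    intervalIntegral.integral_const_mul, intervalIntegral.integral_const_mul]

/-- Four of the profile pairings are integrable on `[0,1]` for kinked profiles:
`g′·conj h′`, `g·conj h′`, `g′·conj h`, `g·conj h`. [folklore] -/
private theorem pairings_integrable' {g g' h h' : ℝ → ℂ} (hg : KinkedProfile g g') (hh : KinkedProfile h h') :
    IntervalIntegrable (fun x => g' x * conj (h' x)) volume 0 1
    ∧ IntervalIntegrable (fun x => g x * conj (h' x)) volume 0 1
    ∧ IntervalIntegrable (fun x => g' x * conj (h x)) volume 0 1
    ∧ IntervalIntegrable (fun x => g x * conj (h x)) volume 0 1 := by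
  have hG := hg.isH1
  have hH := hh.isH1
  refine ⟨hG.intervalIntegrable_deriv_mul_conj_deriv hH, ?_, hG.intervalIntegrable_deriv_mul_conj hH,
    hG.intervalIntegrable_mul_conj hH⟩
  have hc : IntervalIntegrable (fun x => conj (h' x)) volume 0 1 := by
    rw [intervalIntegrable_iff, uIoc_of_le zero_le_one]
    exact hH.memLp_conj.integrable one_le_two
  exact hc.continuousOn_mul (by rw [uIcc_of_le zero_le_one]; exact hg.cont)

/-! ### The `u`-variables and the factorisation of the polar bulk form -/

section UForm

variable {G G' G'' H H' H'' : ℝ → ℂ}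

/-- **The channel operator `D_x G := G′ + iπx·G`** (derivative data `G′` supplied; `D_x` is the `D_c = d/dt + iπc` of
`DetectorRecipeCollapse`'s operator reading; R3a's `u = D_xG/(iπ)`). [cite: Zhang2022LandauSiegel, Prop 7.1 p.44, (7.19)–(7.21)] -/
def dOp (x : ℝ) (G G' : ℝ → ℂ) : ℝ → ℂ := fun t => G' t + I * π * x * G t

/-- `D_x` preserves kinked profiles: `(D_xG)′ = D_x(G′)`. [cite: Zhang2022LandauSiegel, Prop 7.1 p.44, (7.19)–(7.21)] -/
theorem kinkedProfile_dOp (x : ℝ) (hG : KinkedProfile G G') (hG' : KinkedProfile G' G'') :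
    KinkedProfile (dOp x G G') (dOp x G' G'') :=
  hG'.add_smul hG (I * π * x)

/-- **The second-order form `𝔥_a(U,V) := ⟨U′,V′⟩ − (iaπ/2)(⟨U′,V⟩ − ⟨U,V′⟩)`** (`⟨u,v⟩ = ∫₀¹u·conj v`; derivative data
supplied; frequency symbol `π²ξ(ξ+a)` on `e^{iπξy}`; R3a v2's `h_a(u,v)` with `u = U/(iπ)`, division-free). Hermitian
(`conj_uForm`); diagonal `‖U′‖² + aπ·Im⟨U′,U⟩`. [cite: Zhang2022LandauSiegel, Prop 7.1 p.44 with (8.11)–(8.23)] -/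
def uForm (a : ℝ) (U U' V V' : ℝ → ℂ) : ℂ :=
  (∫ y in (0:ℝ)..1, U' y * conj (V' y))
    - I * ((a * π / 2 : ℝ) : ℂ) * ((∫ y in (0:ℝ)..1, U' y * conj (V y)) - ∫ y in (0:ℝ)..1, U y * conj (V' y))

/-- **The boundary density of the factorisation:** `β_{a,x,y}(G,H)(t) = (iπ(y−x)/2)·G′H̄′ + (aπ²/2)(y·G′H̄ + x·GH̄′)` at `t`.
[cite: Zhang2022LandauSiegel, Prop 7.1 p.44 with (8.11)–(8.23)] -/
def uBoundary (a x y : ℝ) (G G' H H' : ℝ → ℂ) (t : ℝ) : ℂ :=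
  I * ((π * (y - x) / 2 : ℝ) : ℂ) * (G' t * conj (H' t))
    + ((a * π ^ 2 / 2 : ℝ) : ℂ) * ((y : ℂ) * (G' t * conj (H t)) + (x : ℂ) * (G t * conj (H' t)))

/-- `𝔥_a` is Hermitian: `conj 𝔥_a(U,V) = 𝔥_a(V,U)`. [cite: Zhang2022LandauSiegel, Prop 7.1 p.44 with (8.11)–(8.23)] -/
theorem conj_uForm (a : ℝ) (U U' V V' : ℝ → ℂ) : conj (uForm a U U' V V') = uForm a V V' U U' := by
  unfold uForm
  simp only [map_sub, map_mul, Complex.conj_ofReal, Complex.conj_I, conj_integral_mul_conj']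
  ring

/-- The diagonal of `𝔥_a` in real data: `Re 𝔥_a(U,U) = Re⟨U′,U′⟩ + aπ·Im⟨U′,U⟩` (and `Im 𝔥_a(U,U) = 0`).
[cite: Zhang2022LandauSiegel, Prop 7.1 p.44 with (8.11)–(8.23)] -/
theorem uForm_self_re (a : ℝ) (U U' : ℝ → ℂ) :
    (uForm a U U' U U').re
      = (∫ y in (0:ℝ)..1, U' y * conj (U' y)).re + a * π * (∫ y in (0:ℝ)..1, U' y * conj (U y)).im := by
  unfold uForm
  have hsw : (∫ y in (0:ℝ)..1, U y * conj (U' y)) = conj (∫ y in (0:ℝ)..1, U' y * conj (U y)) :=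
    (conj_integral_mul_conj' U U').symm
  rw [hsw]
  simp only [Complex.sub_re, Complex.mul_re, Complex.mul_im, Complex.I_re, Complex.I_im, Complex.ofReal_re,
    Complex.ofReal_im, Complex.sub_im, Complex.conj_re, Complex.conj_im]
  ring

/-- `Im 𝔥_a(U,U) = 0`. [cite: Zhang2022LandauSiegel, Prop 7.1 p.44 with (8.11)–(8.23)] -/
theorem uForm_self_im (a : ℝ) (U U' : ℝ → ℂ) : (uForm a U U' U U').im = 0 := by
  have h := congrArg Complex.im (conj_uForm a U U' U U')
  rw [Complex.conj_im] at h
  linarith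

/-- **THE FACTORISATION (SOS plan Part A), every real `a, x, y`:** for profiles `G, H` with kinked data up to second
order (`KinkedProfile G G′`, `KinkedProfile G′ G″`, same for `H`),
`T_{(a,x,y)}^{[0,1]}(G,H) = 𝔥_a(D_xG, D_yH) + β(1) − β(0)` — the differential form of the symbol identity
`ξ(ξ+a)(ξ+x)(ξ+y) = [ξ(ξ+a)]·(ξ+x)·(ξ+y)`; three integrations by parts (`Det.integral_deriv_mul_conj_add`), no
one-sidedness used. [cite: Zhang2022LandauSiegel, Prop 7.1 p.44 with (7.19)–(7.21), (8.11)–(8.23)] -/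
theorem bulkPolarOn_eq_uForm (a x y : ℝ) (hG : KinkedProfile G G') (hG' : KinkedProfile G' G'')
    (hH : KinkedProfile H H') (hH' : KinkedProfile H' H'') :
    bulkPolarOn ![a, x, y] 0 1 G G' G'' H H' H''
      = uForm a (dOp x G G') (dOp x G' G'') (dOp y H H') (dOp y H' H'')
        + (uBoundary a x y G G' H H' 1 - uBoundary a x y G G' H H' 0) := by
  -- the three integrations by parts
  have BPa := integral_deriv_mul_conj_add hG' hH'   -- ⟨G″,H′⟩ + ⟨G′,H″⟩ = [G′H̄′]
  have BPb := integral_deriv_mul_conj_add hG' hH    -- ⟨G″,H⟩ + ⟨G′,H′⟩ = [G′H̄]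
  have BPc := integral_deriv_mul_conj_add hG hH'    -- ⟨G′,H′⟩ + ⟨G,H″⟩ = [GH̄′]
  -- integrability of the eight pairings
  obtain ⟨i22, i12, i21, i11⟩ := pairings_integrable' hG' hH'
  obtain ⟨-, -, i20, i10⟩ := pairings_integrable' hG' hH
  obtain ⟨-, i02, -, i01⟩ := pairings_integrable' hG hH'
  -- LHS in atoms
  have hL : bulkPolarOn ![a, x, y] 0 1 G G' G'' H H' H''
      = (∫ t in (0:ℝ)..1, G'' t * conj (H'' t))
        + I * ((π * (a + x + y) / 2 : ℝ) : ℂ)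
            * ((∫ t in (0:ℝ)..1, G' t * conj (H'' t)) - ∫ t in (0:ℝ)..1, G'' t * conj (H' t))
        + ((π ^ 2 * (a * x + x * y + y * a) : ℝ) : ℂ) * (∫ t in (0:ℝ)..1, G' t * conj (H' t))
        - I * ((π ^ 3 * (a * x * y) / 2 : ℝ) : ℂ)
            * ((∫ t in (0:ℝ)..1, G' t * conj (H t)) - ∫ t in (0:ℝ)..1, G t * conj (H' t)) := by
    unfold bulkPolarOn
    simp only [Matrix.cons_val_zero, Matrix.cons_val_one, Matrix.cons_val_two, Matrix.head_cons, Matrix.tail_cons]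
    set r1 : ℂ := ((π * (a + x + y) / 2 : ℝ) : ℂ)
    set r2 : ℂ := ((π ^ 2 * (a * x + x * y + y * a) : ℝ) : ℂ)
    set r3 : ℂ := ((π ^ 3 * (a * x * y) / 2 : ℝ) : ℂ)
    have hpt : ∀ t ∈ uIcc (0:ℝ) 1,
        (G'' t * conj (H'' t) + I * r1 * (G' t * conj (H'' t) - G'' t * conj (H' t))
          + r2 * (G' t * conj (H' t)) - I * r3 * (G' t * conj (H t) - G t * conj (H' t)))
        = (1 * (G'' t * conj (H'' t)) + (I * r1) * (G' t * conj (H'' t)) + (-(I * r1)) * (G'' t * conj (H' t))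
            + r2 * (G' t * conj (H' t)))
          + ((-(I * r3)) * (G' t * conj (H t)) + (I * r3) * (G t * conj (H' t)) + 0 * (G' t * conj (H' t))
            + 0 * (G' t * conj (H' t))) := by
      intro t _; ring
    rw [intervalIntegral.integral_congr hpt]
    have iA := (((i22.const_mul 1).add (i12.const_mul (I * r1))).add (i21.const_mul (-(I * r1)))).add
      (i11.const_mul r2)
    have iB := (((i10.const_mul (-(I * r3))).add (i01.const_mul (I * r3))).add (i11.const_mul 0)).add
      (i11.const_mul 0)
    rw [intervalIntegral.integral_add iA iB, integral_lin4' _ _ _ _ i22 i12 i21 i11,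
      integral_lin4' _ _ _ _ i10 i01 i11 i11]
    ring
  -- RHS bulk in atoms
  have hR : uForm a (dOp x G G') (dOp x G' G'') (dOp y H H') (dOp y H' H'')
      = (∫ t in (0:ℝ)..1, G'' t * conj (H'' t))
        + I * π * ((x + a / 2 : ℝ) : ℂ) * (∫ t in (0:ℝ)..1, G' t * conj (H'' t))
        - I * π * ((y + a / 2 : ℝ) : ℂ) * (∫ t in (0:ℝ)..1, G'' t * conj (H' t))
        + (π : ℂ) ^ 2 * ((x * y + a * (x + y) / 2 : ℝ) : ℂ) * (∫ t in (0:ℝ)..1, G' t * conj (H' t))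
        - (π : ℂ) ^ 2 * ((a / 2 : ℝ) : ℂ)
            * ((y : ℂ) * (∫ t in (0:ℝ)..1, G'' t * conj (H t)) + (x : ℂ) * (∫ t in (0:ℝ)..1, G t * conj (H'' t)))
        - I * (π : ℂ) ^ 3 * ((a * x * y / 2 : ℝ) : ℂ)
            * ((∫ t in (0:ℝ)..1, G' t * conj (H t)) - ∫ t in (0:ℝ)..1, G t * conj (H' t)) := by
    unfold uForm dOp
    have hc : conj (I * π * y) = -(I * π * y) := by
      simp only [map_mul, Complex.conj_I, Complex.conj_ofReal]; ring
    -- first integral: (G″ + iπxG′)·conj(H″ + iπyH′)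
    have e1 : (∫ t in (0:ℝ)..1, (G'' t + I * π * x * G' t) * conj (H'' t + I * π * y * H' t))
        = (∫ t in (0:ℝ)..1, G'' t * conj (H'' t)) + (-(I * π * y)) * (∫ t in (0:ℝ)..1, G'' t * conj (H' t))
          + (I * π * x) * (∫ t in (0:ℝ)..1, G' t * conj (H'' t))
          + (π ^ 2 * x * y : ℂ) * (∫ t in (0:ℝ)..1, G' t * conj (H' t)) := by
      have hpt : ∀ t ∈ uIcc (0:ℝ) 1, (G'' t + I * π * x * G' t) * conj (H'' t + I * π * y * H' t)
          = 1 * (G'' t * conj (H'' t)) + (-(I * π * y)) * (G'' t * conj (H' t)) + (I * π * x) * (G' t * conj (H'' t))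
            + (π ^ 2 * x * y : ℂ) * (G' t * conj (H' t)) := by
        intro t _
        rw [map_add, map_mul, hc]
        linear_combination (-((π : ℂ) ^ 2 * x * y * (G' t * conj (H' t)))) * Complex.I_mul_I
      rw [intervalIntegral.integral_congr hpt, integral_lin4' _ _ _ _ i22 i21 i12 i11, one_mul]
    -- second: (G″ + iπxG′)·conj(H′ + iπyH)
    have e2 : (∫ t in (0:ℝ)..1, (G'' t + I * π * x * G' t) * conj (H' t + I * π * y * H t))
        = (∫ t in (0:ℝ)..1, G'' t * conj (H' t)) + (-(I * π * y)) * (∫ t in (0:ℝ)..1, G'' t * conj (H t))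
          + (I * π * x) * (∫ t in (0:ℝ)..1, G' t * conj (H' t))
          + (π ^ 2 * x * y : ℂ) * (∫ t in (0:ℝ)..1, G' t * conj (H t)) := by
      have hpt : ∀ t ∈ uIcc (0:ℝ) 1, (G'' t + I * π * x * G' t) * conj (H' t + I * π * y * H t)
          = 1 * (G'' t * conj (H' t)) + (-(I * π * y)) * (G'' t * conj (H t)) + (I * π * x) * (G' t * conj (H' t))
            + (π ^ 2 * x * y : ℂ) * (G' t * conj (H t)) := by
        intro t _
        rw [map_add, map_mul, hc]
        linear_combination (-((π : ℂ) ^ 2 * x * y * (G' t * conj (H t)))) * Complex.I_mul_I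
      rw [intervalIntegral.integral_congr hpt, integral_lin4' _ _ _ _ i21 i20 i11 i10, one_mul]
    -- third: (G′ + iπxG)·conj(H″ + iπyH′)
    have e3 : (∫ t in (0:ℝ)..1, (G' t + I * π * x * G t) * conj (H'' t + I * π * y * H' t))
        = (∫ t in (0:ℝ)..1, G' t * conj (H'' t)) + (-(I * π * y)) * (∫ t in (0:ℝ)..1, G' t * conj (H' t))
          + (I * π * x) * (∫ t in (0:ℝ)..1, G t * conj (H'' t))
          + (π ^ 2 * x * y : ℂ) * (∫ t in (0:ℝ)..1, G t * conj (H' t)) := by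
      have hpt : ∀ t ∈ uIcc (0:ℝ) 1, (G' t + I * π * x * G t) * conj (H'' t + I * π * y * H' t)
          = 1 * (G' t * conj (H'' t)) + (-(I * π * y)) * (G' t * conj (H' t)) + (I * π * x) * (G t * conj (H'' t))
            + (π ^ 2 * x * y : ℂ) * (G t * conj (H' t)) := by
        intro t _
        rw [map_add, map_mul, hc]
        linear_combination (-((π : ℂ) ^ 2 * x * y * (G t * conj (H' t)))) * Complex.I_mul_I
      rw [intervalIntegral.integral_congr hpt, integral_lin4' _ _ _ _ i12 i11 i02 i01, one_mul]
    rw [e1, e2, e3]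
    push_cast
    linear_combination ((a : ℂ) * π ^ 2 / 2 * ((y : ℂ) * (∫ t in (0:ℝ)..1, G'' t * conj (H t))
      - ((x : ℂ) + y) * (∫ t in (0:ℝ)..1, G' t * conj (H' t)) + (x : ℂ) * (∫ t in (0:ℝ)..1, G t * conj (H'' t))))
      * Complex.I_mul_I
  rw [hL, hR]
  unfold uBoundary
  push_cast
  linear_combination (I * π * (y - x) / 2 : ℂ) * BPa + ((a : ℂ) * π ^ 2 / 2 * y) * BPb
    + ((a : ℂ) * π ^ 2 / 2 * x) * BPc

/-- **One-sided (clamped-right) corollary:** if `G(1) = G′(1) = 0` (or the same for `H`), the bracket at `1` vanishes: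
`T_{(a,x,y)}^{[0,1]}(G,H) = 𝔥_a(D_xG, D_yH) − β(0)`. [cite: Zhang2022LandauSiegel, Prop 7.1 p.44 with (7.2), (8.11)–(8.23)] -/
theorem bulkPolarOn_eq_uForm_of_oneSided (a x y : ℝ) (hG : KinkedProfile G G') (hG' : KinkedProfile G' G'')
    (hH : KinkedProfile H H') (hH' : KinkedProfile H' H'') (hG1 : G 1 = 0) (hG'1 : G' 1 = 0) :
    bulkPolarOn ![a, x, y] 0 1 G G' G'' H H' H''
      = uForm a (dOp x G G') (dOp x G' G'') (dOp y H H') (dOp y H' H'') - uBoundary a x y G G' H H' 0 := by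
  rw [bulkPolarOn_eq_uForm a x y hG hG' hH hH']
  unfold uBoundary
  rw [hG1, hG'1]
  ring

/-- **The boundary bracket at `t = 0` as a JET form** in `x = (G(0), G′(0))`, `y = (H(0), H′(0))`:
`β⁰_{a,x,y}(x,y) = (iπ(y−x)/2)·x₂ȳ₂ + (aπ²/2)(y·x₂ȳ₁ + x·x₁ȳ₂)`. [cite: Zhang2022LandauSiegel, Prop 7.1 p.44 with (8.11)–(8.23)] -/
def uBoundaryJet (a x y : ℝ) (x₁ x₂ y₁ y₂ : ℂ) : ℂ :=
  I * ((π * (y - x) / 2 : ℝ) : ℂ) * (x₂ * conj y₂)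
    + ((a * π ^ 2 / 2 : ℝ) : ℂ) * ((y : ℂ) * (x₂ * conj y₁) + (x : ℂ) * (x₁ * conj y₂))

/-- `β(0)` is the jet form on `(G(0), G′(0))`, `(H(0), H′(0))`. [cite: Zhang2022LandauSiegel, Prop 7.1 p.44 with (8.11)–(8.23)] -/
theorem uBoundary_zero_eq_jet (a x y : ℝ) (G G' H H' : ℝ → ℂ) :
    uBoundary a x y G G' H H' 0 = uBoundaryJet a x y (G 0) (G' 0) (H 0) (H' 0) := rfl

/-- `conj β⁰_{a,x,y}(u,v) = β⁰_{a,y,x}(v,u)` (the boundary jet form is Hermitian under the swap of channels).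
[cite: Zhang2022LandauSiegel, Prop 7.1 p.44 with (8.11)–(8.23)] -/
theorem conj_uBoundaryJet (a x y : ℝ) (x₁ x₂ y₁ y₂ : ℂ) :
    conj (uBoundaryJet a x y x₁ x₂ y₁ y₂) = uBoundaryJet a y x y₁ y₂ x₁ x₂ := by
  unfold uBoundaryJet
  simp only [map_add, map_mul, Complex.conj_conj, Complex.conj_ofReal, Complex.conj_I]
  push_cast
  ring

end UForm

/-! ### The tail primitive of a one-sided kinked profile, and the entangled (summed) factorisation -/

section Tail

variable {K : ℕ} {g g' : ℝ → ℂ} {h h' : Fin K → ℝ → ℂ}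

/-- `−g` is kinked with derivative data `−g′`. [cite: Zhang2022LandauSiegel, Prop 7.1 p.44 with (7.2), (8.11)–(8.23)] -/
theorem kinkedProfile_neg (hg : KinkedProfile g g') : KinkedProfile (fun y => -g y) (fun y => -g' y) where
  cont := hg.cont.neg
  hasDeriv := fun x hx => (hg.hasDeriv x hx).neg
  memLp := hg.memLp.neg

/-- **The tail primitive `S_g = ∫_y^1 g` of a kinked profile is kinked with derivative data `−g`** (on `[0,1]` it is
`∫₀¹g − ∫₀^y g`, `Det.tailPrim_eq_sub`). [cite: Zhang2022LandauSiegel, Prop 7.1 p.44 with (7.2), (8.11)–(8.23)] -/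
theorem kinkedProfile_tailPrim (hg : KinkedProfile g g') : KinkedProfile (tailPrim g) (fun y => -g y) := by
  have hP := kinkedProfile_prim hg
  have hgi : IntervalIntegrable g volume 0 1 := hg.cont.intervalIntegrable_of_Icc zero_le_one
  have heq : EqOn (tailPrim g) (fun y => (∫ t in (0:ℝ)..1, g t) - ∫ t in (0:ℝ)..y, g t) (Icc 0 1) :=
    fun y hy => tailPrim_eq_sub hgi hy
  refine ⟨(continuousOn_const.sub hP.cont).congr heq, fun x hx => ?_, (memLp_two_of_continuousOn hg.cont).neg⟩
  have h1 : HasDerivWithinAt (fun y => (∫ t in (0:ℝ)..1, g t) - ∫ t in (0:ℝ)..y, g t) (0 - g x) (Ioi x) x :=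
    (hasDerivWithinAt_const x (Ioi x) _).sub (hP.hasDeriv x hx)
  rw [zero_sub] at h1
  refine h1.congr_of_eventuallyEq ?_ (heq ⟨hx.1.le, hx.2.le⟩)
  filter_upwards [Ioo_mem_nhdsGT hx.2] with y hy
  exact heq ⟨(hx.1.trans hy.1).le, hy.2.le⟩

/-- **The entangled bulk form factorised (SOS plan Part A, summed):** for tail data clamped at `1`
(`S_j(1) = S_j′(1) = 0`) with kinked data up to second order,
`entangledBulk(S,S) = Σ_j Σ_l Re m₀(a,b_j,b_l)·[𝔥_a(D_{b_j}S_j, D_{b_l}S_l) − β_{a,b_j,b_l}(S_j,S_l)(0)]`.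
[cite: Zhang2022LandauSiegel, Prop 7.1 p.44 with (7.2), (7.19)–(7.21), (8.11)–(8.23)] -/
theorem entangledBulk_eq_uForm (a : ℝ) (b : Fin K → ℝ) {S S' S'' : Fin K → ℝ → ℂ}
    (hS : ∀ j, KinkedProfile (S j) (S' j)) (hS' : ∀ j, KinkedProfile (S' j) (S'' j))
    (hS1 : ∀ j, S j 1 = 0) (hS'1 : ∀ j, S' j 1 = 0) :
    entangledBulk a b S S' S'' S S' S''
      = ∑ j, ∑ l, (((ddM0 ![a, b j, b l]).re : ℝ) : ℂ)
          * (uForm a (dOp (b j) (S j) (S' j)) (dOp (b j) (S' j) (S'' j)) (dOp (b l) (S l) (S' l))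
                (dOp (b l) (S' l) (S'' l))
              - uBoundaryJet a (b j) (b l) (S j 0) (S' j 0) (S l 0) (S' l 0)) := by
  unfold entangledBulk
  refine Finset.sum_congr rfl fun j _ => Finset.sum_congr rfl fun l _ => ?_
  rw [bulkPolarOn_eq_uForm_of_oneSided a (b j) (b l) (hS j) (hS' j) (hS l) (hS' l) (hS1 j) (hS'1 j),
    uBoundary_zero_eq_jet]

/-- **The block main-term form in `u`-variables (SOS plan Part A at profile level):** for one-sided kinked `h`
(`h_j(1) = 0`), with `S_j = tailPrim h_j` (`S_j′ = −h_j`, `S_j″ = −h_j′`), `ũ_j = D_{b_j}S_j = −h_j + iπb_j·S_j` and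
jets `x_j = (∫₀¹h_j, −h_j(0))`:
`(π/2)·m(a;b;h) = Σ_{j,l} Re m₀^{jl}·𝔥_a(ũ_j,ũ_l) + [entangledFreeEnd(x,x) − Σ_{j,l} Re m₀^{jl}·β⁰_{a,b_j,b_l}(x_j,x_l)]`
— the «total boundary form» of R3a v2 §1 step (4) is the bracket. [cite: Zhang2022LandauSiegel, Prop 7.1 p.44 with (7.2), (7.19)–(7.21), (8.11)–(8.23)] -/
theorem entangledMain_eq_uForm (a : ℝ) (b : Fin K → ℝ) (hh : ∀ j, KinkedProfile (h j) (h' j))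
    (h1 : ∀ j, h j 1 = 0) :
    ((π / 2 : ℝ) : ℂ) * entangledMain a b h h'
      = (∑ j, ∑ l, (((ddM0 ![a, b j, b l]).re : ℝ) : ℂ)
          * uForm a (dOp (b j) (tailPrim (h j)) (fun y => -h j y)) (dOp (b j) (fun y => -h j y) (fun y => -h' j y))
              (dOp (b l) (tailPrim (h l)) (fun y => -h l y)) (dOp (b l) (fun y => -h l y) (fun y => -h' l y)))
        + (entangledFreeEnd a b (fun j => ∫ x in (0:ℝ)..1, h j x) (fun j => -h j 0)
              (fun j => ∫ x in (0:ℝ)..1, h j x) (fun j => -h j 0)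
            - ∑ j, ∑ l, (((ddM0 ![a, b j, b l]).re : ℝ) : ℂ)
                * uBoundaryJet a (b j) (b l) (∫ x in (0:ℝ)..1, h j x) (-h j 0) (∫ x in (0:ℝ)..1, h l x) (-h l 0)) := by
  rw [entangledMain_eq_bulk_add_freeEnd a b hh h1,
    entangledBulk_eq_uForm a b (fun j => kinkedProfile_tailPrim (hh j)) (fun j => kinkedProfile_neg (hh j))
      (fun j => tailPrim_one (h j)) (fun j => by simp only [h1 j, neg_zero])]
  simp only [tailPrim_zero, mul_sub, Finset.sum_sub_distrib]
  ring

end Tail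

/-! ### Part D (v2 append) — PICONE on `uForm`: for `θ ∈ (0, π/2)` and profiles clamped at `1`,
`𝔥_{2θ/π}(U,V) = ∫₀¹ (U′ + θ(i + tan θy)·U)·conj(V′ + θ(i + tan θy)·V) dy` (ground state `φ = cos θy > 0` on `[0,1]`) -/

section Picone

variable {U U' V V' : ℝ → ℂ} {θ : ℝ}

/-- `cos(θy) > 0` for `θ ∈ (0, π/2)` and `y ∈ [0,1]`. [folklore] -/
private theorem cos_pos_unit (hθ : θ ∈ Ioo 0 (π / 2)) {y : ℝ} (hy : y ∈ Icc (0:ℝ) 1) : 0 < Real.cos (θ * y) := by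
  apply Real.cos_pos_of_mem_Ioo
  constructor
  · have : 0 ≤ θ * y := mul_nonneg hθ.1.le hy.1
    linarith [Real.pi_pos]
  · calc θ * y ≤ θ * 1 := mul_le_mul_of_nonneg_left hy.2 hθ.1.le
      _ < π / 2 := by rw [mul_one]; exact hθ.2

/-- `d/dy tan(θy) = θ·(1 + tan²(θy))` on `[0,1]` (as a complex-valued function). [folklore] -/
private theorem hasDerivAt_tan_mul (hθ : θ ∈ Ioo 0 (π / 2)) {y : ℝ} (hy : y ∈ Icc (0:ℝ) 1) :
    HasDerivAt (fun y => ((Real.tan (θ * y) : ℝ) : ℂ)) (((θ * (1 + Real.tan (θ * y) ^ 2) : ℝ) : ℂ)) y := by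
  have hc : Real.cos (θ * y) ≠ 0 := (cos_pos_unit hθ hy).ne'
  have h1 : HasDerivAt (fun y => θ * y) θ y := by simpa using (hasDerivAt_id y).const_mul θ
  have h2 : HasDerivAt (fun y => Real.tan (θ * y)) (1 / Real.cos (θ * y) ^ 2 * θ) y :=
    (Real.hasDerivAt_tan hc).comp y h1
  have h4 : 1 + Real.tan (θ * y) ^ 2 = 1 / Real.cos (θ * y) ^ 2 := by
    rw [← Real.inv_one_add_tan_sq hc, one_div, inv_inv]
  have h3 : 1 / Real.cos (θ * y) ^ 2 * θ = θ * (1 + Real.tan (θ * y) ^ 2) := by rw [h4]; ring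
  rw [h3] at h2
  exact h2.ofReal_comp

/-- **PICONE ON `uForm` (SOS plan Part D).** For kinked `U, V` clamped at `1` (`U(1) = V(1) = 0`) and
`θ ∈ (0, π/2)`:
`𝔥_{2θ/π}(U,V) = ∫₀¹ (U′(y) + θ(i + tan(θy))·U(y))·conj(V′(y) + θ(i + tan(θy))·V(y)) dy`
— pointwise the two integrands differ by `(θ·tan(θy)·U·V̄)′` (since `tan′ = 1 + tan²` and `(i+t)(−i+t) = 1+t²`),
whose integral is `θ·tanθ·U(1)·V̄(1) − 0 = 0`. With a PSD weight this makes the bulk of the SOS identity a Gram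
integral (ground state `φ = cos θy > 0` on `[0,1]` iff `θ < π/2`, i.e. anchor `a = 2θ/π < 1`).
[cite: Zhang2022LandauSiegel, Prop 7.1 p.44 with (7.2), (8.11)–(8.23)] -/
theorem uForm_eq_integral_picone (hU : KinkedProfile U U') (hV : KinkedProfile V V') (hU1 : U 1 = 0)
    (hV1 : V 1 = 0) (hθ : θ ∈ Ioo 0 (π / 2)) :
    uForm (2 * θ / π) U U' V V'
      = ∫ y in (0:ℝ)..1, (U' y + (θ : ℂ) * (I + (Real.tan (θ * y) : ℂ)) * U y)
          * conj (V' y + (θ : ℂ) * (I + (Real.tan (θ * y) : ℂ)) * V y) := by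
  have _ := hV1
  -- the boundary function Φ(y) = θ·tan(θy)·U(y)·conj V(y) and its derivative
  set τ : ℝ → ℂ := fun y => ((Real.tan (θ * y) : ℝ) : ℂ) with hτ
  set τ' : ℝ → ℂ := fun y => ((θ * (1 + Real.tan (θ * y) ^ 2) : ℝ) : ℂ) with hτ'
  have hτc : ContinuousOn τ (Icc 0 1) := fun y hy => (hasDerivAt_tan_mul hθ hy).continuousAt.continuousWithinAt
  have hτ'c : ContinuousOn τ' (Icc 0 1) := by
    have : ContinuousOn (fun y => ((θ : ℝ) : ℂ) * (1 + τ y ^ 2)) (Icc 0 1) :=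
      continuousOn_const.mul (continuousOn_const.add (hτc.pow 2))
    refine this.congr fun y _ => ?_
    simp only [hτ', hτ]; push_cast; ring
  have hΦc : ContinuousOn (fun y => (θ : ℂ) * τ y * (U y * conj (V y))) (Icc 0 1) :=
    (continuousOn_const.mul hτc).mul (hU.cont.mul (continuousOn_conj_comp hV.cont))
  have hΦd : ∀ y ∈ Ioo (0:ℝ) 1, HasDerivWithinAt (fun y => (θ : ℂ) * τ y * (U y * conj (V y)))
      ((θ : ℂ) * τ' y * (U y * conj (V y)) + (θ : ℂ) * τ y * (U' y * conj (V y) + U y * conj (V' y)))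
      (Ioi y) y := by
    intro y hy
    have h1 : HasDerivWithinAt (fun y => (θ : ℂ) * τ y) ((θ : ℂ) * τ' y) (Ioi y) y :=
      ((hasDerivAt_tan_mul hθ ⟨hy.1.le, hy.2.le⟩).hasDerivWithinAt).const_mul _
    have h2 : HasDerivWithinAt (fun y => conj (V y)) (conj (V' y)) (Ioi y) y := by
      have := (hV.hasDeriv y hy).star
      simpa only [starRingEnd_apply] using this
    exact h1.mul ((hU.hasDeriv y hy).mul h2)
  obtain ⟨i1, i2, i3, i4⟩ := pairings_integrable' hU hV
  have hΦ'i : IntervalIntegrable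
      (fun y => (θ : ℂ) * τ' y * (U y * conj (V y)) + (θ : ℂ) * τ y * (U' y * conj (V y) + U y * conj (V' y)))
      volume 0 1 := by
    refine IntervalIntegrable.add ?_ ?_
    · exact ((continuousOn_const.mul hτ'c).mul (hU.cont.mul (continuousOn_conj_comp hV.cont))).intervalIntegrable_of_Icc
        zero_le_one
    · exact (i3.add i2).continuousOn_mul (by rw [uIcc_of_le zero_le_one]; exact continuousOn_const.mul hτc)
  have key := intervalIntegral.integral_eq_sub_of_hasDeriv_right_of_le zero_le_one hΦc hΦd hΦ'i
  have hb : (θ : ℂ) * τ 1 * (U 1 * conj (V 1)) - (θ : ℂ) * τ 0 * (U 0 * conj (V 0)) = 0 := by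
    simp [hτ, hU1]
  rw [hb] at key
  -- pointwise expansion of the Picone integrand
  have hpt : ∀ y ∈ uIcc (0:ℝ) 1,
      (U' y + (θ : ℂ) * (I + (Real.tan (θ * y) : ℂ)) * U y) * conj (V' y + (θ : ℂ) * (I + (Real.tan (θ * y) : ℂ)) * V y)
        = 1 * (U' y * conj (V' y)) + (-(I * θ)) * (U' y * conj (V y)) + (I * θ) * (U y * conj (V' y))
          + 1 * ((θ : ℂ) * τ' y * (U y * conj (V y)) + (θ : ℂ) * τ y * (U' y * conj (V y) + U y * conj (V' y))) := by
    intro y _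
    simp only [hτ, hτ', map_add, map_mul, Complex.conj_ofReal, Complex.conj_I]
    push_cast
    linear_combination (-((θ : ℂ) ^ 2 * (U y * conj (V y)))) * Complex.I_mul_I
  rw [intervalIntegral.integral_congr hpt, integral_lin4' _ _ _ _ i1 i3 i2 hΦ'i, key]
  unfold uForm
  have hπ : (π : ℝ) ≠ 0 := Real.pi_ne_zero
  rw [show (2 * θ / π * π / 2 : ℝ) = θ by field_simp]
  ring

/-- **Picone on `uForm`, anchor spelling:** for `a ∈ (0,1)`, `θ = πa/2`,
`𝔥_a(U,V) = ∫₀¹ (U′ + θ(i + tan θy)U)·conj(V′ + θ(i + tan θy)V)`, `U(1) = V(1) = 0`.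
[cite: Zhang2022LandauSiegel, Prop 7.1 p.44 with (7.2), (8.11)–(8.23)] -/
theorem uForm_eq_integral_picone_anchor {a : ℝ} (hU : KinkedProfile U U') (hV : KinkedProfile V V')
    (hU1 : U 1 = 0) (hV1 : V 1 = 0) (ha : a ∈ Ioo (0:ℝ) 1) :
    uForm a U U' V V'
      = ∫ y in (0:ℝ)..1, (U' y + ((π * a / 2 : ℝ) : ℂ) * (I + (Real.tan (π * a / 2 * y) : ℂ)) * U y)
          * conj (V' y + ((π * a / 2 : ℝ) : ℂ) * (I + (Real.tan (π * a / 2 * y) : ℂ)) * V y) := by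
  have hθ : π * a / 2 ∈ Ioo 0 (π / 2) := by
    constructor
    · have := mul_pos Real.pi_pos ha.1; linarith
    · have := mul_lt_mul_of_pos_left ha.2 Real.pi_pos; linarith
  have h := uForm_eq_integral_picone hU hV hU1 hV1 hθ
  have hπ : (π : ℝ) ≠ 0 := Real.pi_ne_zero
  rw [show (2 * (π * a / 2) / π : ℝ) = a by field_simp] at h
  rw [h]

end Picone

/-! ### Part 4 (v3 append) — the BULK GRAM INTEGRAL `Σ_{j,l} R_{jl}·𝔥_a(U_j,U_l) = ∫₀¹ Σ_{j,l} R_{jl}·φ_j·conj φ_l` and its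
SIGN for the anchor kernel `R = [Re m₀(a,x_j,x_l)]` (L-B′1, `DetectorAnchorKernel`) -/

section Gram

variable {K : ℕ} {a : ℝ} {U U' : Fin K → ℝ → ℂ}

/-- `πa/2 ∈ (0, π/2)` for `a ∈ (0,1)`. [folklore] -/
private theorem half_pi_mul_mem {a : ℝ} (ha : a ∈ Ioo (0:ℝ) 1) : π * a / 2 ∈ Ioo 0 (π / 2) := by
  constructor
  · have := mul_pos Real.pi_pos ha.1; linarith
  · have := mul_lt_mul_of_pos_left ha.2 Real.pi_pos; linarith

/-- The Picone coefficient `y ↦ θ(i + tan θy)` is continuous on `[0,1]` for `θ ∈ (0,π/2)`. [folklore] -/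
private theorem continuousOn_piconeCoeff {θ : ℝ} (hθ : θ ∈ Ioo 0 (π / 2)) :
    ContinuousOn (fun y => (θ : ℂ) * (I + (Real.tan (θ * y) : ℂ))) (Icc (0:ℝ) 1) := by
  have hτc : ContinuousOn (fun y => ((Real.tan (θ * y) : ℝ) : ℂ)) (Icc (0:ℝ) 1) :=
    fun y hy => (hasDerivAt_tan_mul hθ hy).continuousAt.continuousWithinAt
  exact continuousOn_const.mul (continuousOn_const.add hτc)

/-- The Picone field `φ = V′ + θ(i + tan θy)·V` of a kinked profile is square-integrable on `[0,1]`. [folklore] -/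
private theorem memLp_piconeField {θ : ℝ} (hθ : θ ∈ Ioo 0 (π / 2)) {V V' : ℝ → ℂ} (hV : KinkedProfile V V') :
    MemLp (fun y => V' y + (θ : ℂ) * (I + (Real.tan (θ * y) : ℂ)) * V y) 2 (volume.restrict (Ioc (0:ℝ) 1)) :=
  hV.memLp.add (memLp_two_of_continuousOn ((continuousOn_piconeCoeff hθ).mul hV.cont))

/-- Products of two Picone fields are integrable on `[0,1]` (`L² × L² ⊂ L¹`). [folklore] -/
private theorem intervalIntegrable_piconeField_mul_conj {θ : ℝ} (hθ : θ ∈ Ioo 0 (π / 2)) {V V' W W' : ℝ → ℂ}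
    (hV : KinkedProfile V V') (hW : KinkedProfile W W') :
    IntervalIntegrable (fun y => (V' y + (θ : ℂ) * (I + (Real.tan (θ * y) : ℂ)) * V y)
      * conj (W' y + (θ : ℂ) * (I + (Real.tan (θ * y) : ℂ)) * W y)) volume 0 1 := by
  rw [intervalIntegrable_iff, uIoc_of_le zero_le_one]
  have hW2 : MemLp (fun y => conj (W' y + (θ : ℂ) * (I + (Real.tan (θ * y) : ℂ)) * W y)) 2
      (volume.restrict (Ioc (0:ℝ) 1)) :=
    (Complex.conjCLE.toContinuousLinearMap).comp_memLp' (memLp_piconeField hθ hW)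
  exact (memLp_piconeField hθ hV).integrable_mul hW2

/-- **The weighted sum of Picone forms is ONE Gram integral:** for `a ∈ (0,1)`, any complex weights `R_{jl}` and
kinked `U_j` clamped at `1`,
`Σ_{j,l} R_{jl}·𝔥_a(U_j,U_l) = ∫₀¹ Σ_{j,l} R_{jl}·φ_j(y)·conj φ_l(y) dy`, `φ_j = U_j′ + θ(i + tan θy)U_j`, `θ = πa/2`.
[cite: Zhang2022LandauSiegel, Prop 7.1 p.44 with (7.2), (7.19)–(7.21), (8.11)–(8.23)] -/
theorem sum_mul_uForm_eq_integral (ha : a ∈ Ioo (0:ℝ) 1) (R : Fin K → Fin K → ℂ)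
    (hU : ∀ j, KinkedProfile (U j) (U' j)) (hU1 : ∀ j, U j 1 = 0) :
    ∑ j, ∑ l, R j l * uForm a (U j) (U' j) (U l) (U' l)
      = ∫ y in (0:ℝ)..1, ∑ j, ∑ l, R j l *
          ((U' j y + ((π * a / 2 : ℝ) : ℂ) * (I + (Real.tan (π * a / 2 * y) : ℂ)) * U j y)
            * conj (U' l y + ((π * a / 2 : ℝ) : ℂ) * (I + (Real.tan (π * a / 2 * y) : ℂ)) * U l y)) := by
  have hθ := half_pi_mul_mem ha
  have hint : ∀ j l, IntervalIntegrable (fun y => R j l *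
      ((U' j y + ((π * a / 2 : ℝ) : ℂ) * (I + (Real.tan (π * a / 2 * y) : ℂ)) * U j y)
        * conj (U' l y + ((π * a / 2 : ℝ) : ℂ) * (I + (Real.tan (π * a / 2 * y) : ℂ)) * U l y))) volume 0 1 := by
    intro j l
    have h := (intervalIntegrable_piconeField_mul_conj hθ (hU j) (hU l)).const_mul (R j l)
    refine h.congr fun y _ => ?_
    push_cast
    ring_nf
  rw [intervalIntegral.integral_finsetSum (fun j _ => ?_)]
  · refine Finset.sum_congr rfl fun j _ => ?_
    rw [intervalIntegral.integral_finsetSum (fun l _ => hint j l)]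
    refine Finset.sum_congr rfl fun l _ => ?_
    rw [intervalIntegral.integral_const_mul, uForm_eq_integral_picone_anchor (hU j) (hU l) (hU1 j) (hU1 l) ha]
  · have := IntervalIntegrable.sum (Finset.univ : Finset (Fin K)) (fun l _ => hint j l)
    refine this.congr fun y _ => ?_
    simp only [Finset.sum_apply]

/-- Real part commutes with `∫₀¹`. [folklore] -/
private theorem integral_re_unit' {f : ℝ → ℂ} (hf : IntervalIntegrable f volume 0 1) :
    (∫ x in (0:ℝ)..1, f x).re = ∫ x in (0:ℝ)..1, (f x).re := by
  have h := Complex.reCLM.intervalIntegral_comp_comm hf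
  simpa only [Complex.reCLM_apply] using h.symm

/-- **SIGN OF THE BULK (SOS plan, bulk step of Part E):** for `a ∈ (0,1)`, any real points `x_j` and kinked `U_j`
clamped at `1`, `0 ≤ Re Σ_{j,l} Re m₀(a,x_j,x_l)·𝔥_a(U_j,U_l)` — the Gram integrand is pointwise `≥ 0` by L-B′1
(`Det.re_ddM0_quadForm_nonneg`, `DetectorAnchorKernel`). [cite: Zhang2022LandauSiegel, Prop 7.1 p.44 with (7.2), (7.19)–(7.21), (8.11)–(8.23)] -/
theorem re_sum_uForm_nonneg (ha : a ∈ Ioo (0:ℝ) 1) (x : Fin K → ℝ) (hU : ∀ j, KinkedProfile (U j) (U' j))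
    (hU1 : ∀ j, U j 1 = 0) :
    0 ≤ (∑ j, ∑ l, (((ddM0 ![a, x j, x l]).re : ℝ) : ℂ) * uForm a (U j) (U' j) (U l) (U' l)).re := by
  have hθ := half_pi_mul_mem ha
  set φ : Fin K → ℝ → ℂ := fun j y =>
    U' j y + ((π * a / 2 : ℝ) : ℂ) * (I + (Real.tan (π * a / 2 * y) : ℂ)) * U j y with hφ
  rw [sum_mul_uForm_eq_integral ha _ hU hU1]
  have hint : IntervalIntegrable (fun y => ∑ j, ∑ l, (((ddM0 ![a, x j, x l]).re : ℝ) : ℂ) * (φ j y * conj (φ l y)))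
      volume 0 1 := by
    have h1 : ∀ j l, IntervalIntegrable (fun y => (((ddM0 ![a, x j, x l]).re : ℝ) : ℂ) * (φ j y * conj (φ l y)))
        volume 0 1 := fun j l => by
      have h := (intervalIntegrable_piconeField_mul_conj hθ (hU j) (hU l)).const_mul (((ddM0 ![a, x j, x l]).re : ℝ) : ℂ)
      refine h.congr fun y _ => ?_
      simp only [hφ]
    have h2 : ∀ j, IntervalIntegrable (fun y => ∑ l, (((ddM0 ![a, x j, x l]).re : ℝ) : ℂ) * (φ j y * conj (φ l y)))
        volume 0 1 := fun j => by
      have := IntervalIntegrable.sum (Finset.univ : Finset (Fin K)) (fun l _ => h1 j l)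
      refine this.congr fun y _ => ?_
      simp only [Finset.sum_apply]
    have := IntervalIntegrable.sum (Finset.univ : Finset (Fin K)) (fun j _ => h2 j)
    refine this.congr fun y _ => ?_
    simp only [Finset.sum_apply]
  have hre := integral_re_unit' hint
  simp only [hφ] at hre
  rw [hre]
  refine intervalIntegral.integral_nonneg zero_le_one fun y _ => ?_
  have hpos := re_ddM0_quadForm_nonneg (a := a) ⟨ha.1, by linarith [ha.2]⟩ x (fun j => φ j y)
  have e : (∑ j, ∑ l, (((ddM0 ![a, x j, x l]).re : ℝ) : ℂ) * (φ j y * conj (φ l y)))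
      = ∑ j, ∑ l, (((ddM0 ![a, x j, x l]).re : ℝ) : ℂ) * (φ l y * conj (φ j y)) := by
    rw [Finset.sum_comm]
    refine Finset.sum_congr rfl fun j _ => Finset.sum_congr rfl fun l _ => ?_
    rw [ddM0_swap a (x j) (x l)]
  simp only [hφ] at e hpos
  rw [e]
  exact hpos

end Gram

/-! ### Part 5 (v4 append) — HEAD 1 REDUCED TO THE BOUNDARY BRACKET: `(π/2)·Re m(a;b;h) ≥ Re 𝔅′(a;b)(x_h,x_h)` and the
interface «boundary bracket non-negative on jets ⇒ `ConePSD a b`» -/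

section Reduction

variable {K : ℕ} {a : ℝ} {h h' : Fin K → ℝ → ℂ}

/-- **The TOTAL BOUNDARY BRACKET** of an anchored palette on jet vectors `(x₁, x₂)`, `(y₁, y₂)`:
`𝔅′(a;b)(x,y) := Σ_j Σ_l [F_{(a,b_j,b_l)}(x_j, y_l) − Re m₀(a,b_j,b_l)·β⁰_{a,b_j,b_l}(x_j, y_l)]` (`F = Det.freeEndPolarDD`,
`β⁰ = Det.uBoundaryJet`) — the `2K × 2K` Hermitian jet form that the SOS plan's Parts B–C express as
`Σ_{jl}[π²θcotθ·R^{jl}ω_jω̄_l + (π³/(4 sinθ))·L_jL̄_l]`. Design data; nothing asserted.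
[cite: Zhang2022LandauSiegel, Prop 7.1 p.44 with (7.2), (8.11)–(8.23)] -/
def boundaryBracket (a : ℝ) {K : ℕ} (b : Fin K → ℝ) (x₁ x₂ y₁ y₂ : Fin K → ℂ) : ℂ :=
  ∑ j, ∑ l, (freeEndPolarDD ![a, b j, b l] (x₁ j) (x₂ j) (y₁ l) (y₂ l)
    - (((ddM0 ![a, b j, b l]).re : ℝ) : ℂ) * uBoundaryJet a (b j) (b l) (x₁ j) (x₂ j) (y₁ l) (y₂ l))

/-- `𝔅′ = entangledFreeEnd − Σ R·β⁰` (unfolding). [cite: Zhang2022LandauSiegel, Prop 7.1 p.44 with (7.2), (8.11)–(8.23)] -/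
theorem boundaryBracket_eq (a : ℝ) (b : Fin K → ℝ) (x₁ x₂ y₁ y₂ : Fin K → ℂ) :
    boundaryBracket a b x₁ x₂ y₁ y₂
      = entangledFreeEnd a b x₁ x₂ y₁ y₂
        - ∑ j, ∑ l, (((ddM0 ![a, b j, b l]).re : ℝ) : ℂ) * uBoundaryJet a (b j) (b l) (x₁ j) (x₂ j) (y₁ l) (y₂ l) := by
  unfold boundaryBracket entangledFreeEnd
  simp only [Finset.sum_sub_distrib]

/-- **The block form as bulk Gram sum + boundary bracket** (restatement of `entangledMain_eq_uForm` with the bracket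
named): `(π/2)·m(a;b;h) = Σ_{jl} Re m₀^{jl}·𝔥_a(ũ_j,ũ_l) + 𝔅′(a;b)(x_h,x_h)`, `ũ_j = D_{b_j}S_j`, `x_{h,j} = (∫₀¹h_j, −h_j(0))`.
[cite: Zhang2022LandauSiegel, Prop 7.1 p.44 with (7.2), (7.19)–(7.21), (8.11)–(8.23)] -/
theorem entangledMain_eq_uForm_add_boundaryBracket (a : ℝ) (b : Fin K → ℝ) (hh : ∀ j, KinkedProfile (h j) (h' j))
    (h1 : ∀ j, h j 1 = 0) :
    ((π / 2 : ℝ) : ℂ) * entangledMain a b h h'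
      = (∑ j, ∑ l, (((ddM0 ![a, b j, b l]).re : ℝ) : ℂ)
          * uForm a (dOp (b j) (tailPrim (h j)) (fun y => -h j y)) (dOp (b j) (fun y => -h j y) (fun y => -h' j y))
              (dOp (b l) (tailPrim (h l)) (fun y => -h l y)) (dOp (b l) (fun y => -h l y) (fun y => -h' l y)))
        + boundaryBracket a b (fun j => ∫ x in (0:ℝ)..1, h j x) (fun j => -h j 0)
            (fun j => ∫ x in (0:ℝ)..1, h j x) (fun j => -h j 0) := by
  rw [entangledMain_eq_uForm a b hh h1, boundaryBracket_eq]

/-- The channel `u`-variable `ũ_j = D_{b_j}S_j = −h_j + iπb_j·S_j` of a one-sided kinked profile is kinked and clamped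
at `1`. [cite: Zhang2022LandauSiegel, Prop 7.1 p.44 with (7.2), (8.11)–(8.23)] -/
theorem kinkedProfile_dOp_tailPrim {g g' : ℝ → ℂ} (x : ℝ) (hg : KinkedProfile g g') (hg1 : g 1 = 0) :
    KinkedProfile (dOp x (tailPrim g) (fun y => -g y)) (dOp x (fun y => -g y) (fun y => -g' y))
      ∧ dOp x (tailPrim g) (fun y => -g y) 1 = 0 := by
  refine ⟨kinkedProfile_dOp x (kinkedProfile_tailPrim hg) (kinkedProfile_neg hg), ?_⟩
  simp [dOp, tailPrim_one, hg1]

/-- **HEAD 1 REDUCED TO THE BOUNDARY BRACKET:** for `a ∈ (0,1)`, every real palette and every one-sided kinked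
profile vector, `Re 𝔅′(a;b)(x_h,x_h) ≤ (π/2)·Re m(a;b;h)` — the bulk Gram sum has non-negative real part
(`re_sum_uForm_nonneg` ∘ L-B′1). [cite: Zhang2022LandauSiegel, Prop 7.1 p.44 with (7.2), (7.19)–(7.21), (8.11)–(8.23)] -/
theorem re_boundaryBracket_le_re_entangledMain (ha : a ∈ Ioo (0:ℝ) 1) (b : Fin K → ℝ)
    (hh : ∀ j, KinkedProfile (h j) (h' j)) (h1 : ∀ j, h j 1 = 0) :
    (boundaryBracket a b (fun j => ∫ x in (0:ℝ)..1, h j x) (fun j => -h j 0)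
        (fun j => ∫ x in (0:ℝ)..1, h j x) (fun j => -h j 0)).re
      ≤ π / 2 * (entangledMain a b h h').re := by
  have hU := fun j => (kinkedProfile_dOp_tailPrim (b j) (hh j) (h1 j)).1
  have hU1 := fun j => (kinkedProfile_dOp_tailPrim (b j) (hh j) (h1 j)).2
  have hbulk := re_sum_uForm_nonneg ha b hU hU1
  have hid := congrArg Complex.re (entangledMain_eq_uForm_add_boundaryBracket a b hh h1)
  rw [Complex.re_ofReal_mul, Complex.add_re] at hid
  linarith

/-- **The SOS interface for head 1:** if the boundary bracket has non-negative real part on every jet datum of a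
one-sided kinked profile vector (the SOS plan's Parts B–C: it is `Σ[π²θcotθ·R^{jl}ω_jω̄_l + (π³/(4 sinθ))L_jL̄_l]`,
non-negative by L-B′1 and a square), then `ConePSD a b` — for `a ∈ (0,1)` and EVERY real palette `b` (no box).
[cite: Zhang2022LandauSiegel, Prop 7.1 p.44 with (7.2), (7.19)–(7.21), (8.11)–(8.23)] -/
theorem conePSD_of_re_boundaryBracket_nonneg (ha : a ∈ Ioo (0:ℝ) 1) (b : Fin K → ℝ)
    (hB : ∀ h h' : Fin K → ℝ → ℂ, (∀ j, KinkedProfile (h j) (h' j)) → (∀ j, h j 1 = 0) →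
      0 ≤ (boundaryBracket a b (fun j => ∫ x in (0:ℝ)..1, h j x) (fun j => -h j 0)
        (fun j => ∫ x in (0:ℝ)..1, h j x) (fun j => -h j 0)).re) :
    ConePSD a b := by
  intro h h' hh h1
  have h0 := hB h h' hh h1
  have h2 := re_boundaryBracket_le_re_entangledMain ha b hh h1
  have hπ : 0 < π / 2 := by positivity
  nlinarith

/-- … and the jet-level version: non-negativity of `Re 𝔅′` on ALL jet vectors suffices.
[cite: Zhang2022LandauSiegel, Prop 7.1 p.44 with (7.2), (7.19)–(7.21), (8.11)–(8.23)] -/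
theorem conePSD_of_re_boundaryBracket_nonneg_jets (ha : a ∈ Ioo (0:ℝ) 1) (b : Fin K → ℝ)
    (hB : ∀ x₁ x₂ : Fin K → ℂ, 0 ≤ (boundaryBracket a b x₁ x₂ x₁ x₂).re) : ConePSD a b :=
  conePSD_of_re_boundaryBracket_nonneg ha b fun _ _ _ _ => hB _ _

/-- **Named glue (v5, the shape asked by ls-barrier-p2 g4):** the bulk Gram sum of `entangledMain_eq_uForm` — the
anchor kernel `Re m₀(a,b_j,b_l)` against `uForm a ũ_j ũ_l`, `ũ_j = D_{b_j}S_j = dOp (b j) (tailPrim (h j)) (−h j)` — has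
non-negative real part for `a ∈ (0,1)`, every real palette `b` and every one-sided kinked profile vector
(`re_sum_uForm_nonneg`, i.e. Picone + L-B′1, at the profiles supplied by `kinkedProfile_dOp_tailPrim`).
[cite: Zhang2022LandauSiegel, Prop 7.1 p.44 with (7.2), (7.19)–(7.21), (8.11)–(8.23)] -/
theorem re_sum_uForm_dOp_nonneg (ha : a ∈ Ioo (0:ℝ) 1) (b : Fin K → ℝ)
    (hh : ∀ j, KinkedProfile (h j) (h' j)) (h1 : ∀ j, h j 1 = 0) :
    0 ≤ (∑ j, ∑ l, (((ddM0 ![a, b j, b l]).re : ℝ) : ℂ) *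
      uForm a (dOp (b j) (tailPrim (h j)) (fun y => -h j y)) (dOp (b j) (fun y => -h j y) (fun y => -h' j y))
        (dOp (b l) (tailPrim (h l)) (fun y => -h l y)) (dOp (b l) (fun y => -h l y) (fun y => -h' l y))).re :=
  re_sum_uForm_nonneg ha b (fun j => (kinkedProfile_dOp_tailPrim (b j) (hh j) (h1 j)).1)
    (fun j => (kinkedProfile_dOp_tailPrim (b j) (hh j) (h1 j)).2)

end Reduction

end Det

end Literature.NumberTheory.LFunctions.Zhang2022
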